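/-
Copyright (c) 2026. All rights reserved.
Released under Apache 2.0 license as described in the file LICENSE.
Authors: abc-iut cell, prover seat abc-iut-rh2-L1 (R-H round 2, row 27 «reach-ledger», gen 2).
-/
import Literature.IUT.LogVolume.UnitLogTieAttained
import Literature.IUT.LogVolume.UnitLogValuationProfileBelowTies
import HarnessLib

/-!
# The valuation profile of `log_p(𝒪_K^×)` at a TIE level: the envelope value is NOT attained at CYCLOTOMIC TYPE

Proof-only sequel (theorems, no definitions, no named fact) of abc-iut-rp-x2's `UnitLogTieAttained.lean` (the
envelope value `‖ϖ‖^{p^{a₀} − e·a₀}` of `log_p(𝒪_K^×)` at a cyclotomic index `e = p^{a₀}·(p−1)` IS attained when `f ≥ 2`,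
or — (NZ)-free read-out `norm_logSeries_eq_zpow_of_tie_of_unit` — as soon as one principal unit `y` of level `1`
passes the unit test `‖1 + (1−y)^e/p‖ = 1`).  HERE THE CONVERSE: if EVERY element `π` of uniformizer norm FAILS the
test (`‖1 + π^e/p‖ < 1` — the CYCLOTOMIC TYPE, e.g. `K ⊇ ℚ_p(ζ_p)` totally ramified with residue field `𝔽_p`, where
`π^e/p ≡ −1`), then NO `z ∈ log_p(𝒪_K^×)` reaches the envelope: `‖z‖ ≤ ‖ϖ‖^{p^{a₀} − e·a₀ + 1}` for all of them.  Setting: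
`K` a proper ultrametric normed `ℚ_p`-algebra field (ANY prime `p`), `e = absRamificationIdx p K`, `ϖ` a norm
uniformizer.  PROVED:

* §1 `norm_logSeries_le_zpow_succ_of_two_dominant` — the CANCELLING twin of abc-iut-rp-d4's
  `norm_logSeries_eq_zpow_of_two_dominant`: if the two dominant terms of `L(y)` SUM to norm `≤ ‖ϖ‖^{N₀+1}` and every
  other term has exponent `≥ N₀ + 1`, then `‖L(y)‖ ≤ ‖ϖ‖^{N₀+1}` (ultrametric inequality on the regrouped series);
  `norm_add_le_of_tie_of_norm_le` — at a tie of level `s` the two tying terms sum to `T₀·(1 + x^{p^{a₀}(p−1)}/p)`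
  (`x = 1 − y`), so a FAILED unit test `‖1 + x^{p^{a₀}(p−1)}/p‖ ≤ ‖ϖ‖` bounds the sum by `‖ϖ‖^{s·p^{a₀} − e·a₀ + 1}`;
  `norm_logSeries_le_zpow_succ_of_tie_of_norm_le` — hence `‖L(y)‖ ≤ ‖ϖ‖^{s·p^{a₀} − e·a₀ + 1}` for such `y`
  (all other exponents are `≥ N₀ + 1` by rp-d4's `exponent_lower_of_tie`).
* §2 `norm_le_unif_of_norm_lt_one` (discreteness) and **`norm_le_zpow_succ_of_mem_logUnits_of_cyclotomicType`** —
  `e = p^{a₀}·(p−1)` and `‖1 + π^{p^{a₀}(p−1)}/p‖ < 1` for every `π` with `‖π‖ = ‖ϖ‖` ⟹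
  **`‖z‖ ≤ ‖ϖ‖^{p^{a₀} − e·a₀ + 1}` for every `z ∈ log_p(𝒪_K^×)`**: a log-unit of level `1` is `m⁻¹·L(uᵐ)` with
  `1 − uᵐ` of uniformizer norm (§1 applies); one of level `s ≥ 2` has norm `≤ ‖ϖ‖^{N(s)}` (c312-3's
  `norm_logSeries_le_zpow_level`) and `N(s) ≥ 2p^{a} − e·a ≥ 1 + (p^{a₀} − e·a₀)` (`exponent_min`).
So at a cyclotomic-type field the OUTER radius of `log_p(𝒪_K^×)` is STRICTLY inside the envelope: `r_out ≥ B♯ + 1`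
(`ℚ_p(ζ_p)`: `log_p(𝒪^×) = 𝔪²`, `CyclotomicPrime.logUnits_eq_closedBall_sq`, is the case `a₀ = 0`).  Consumer (record only):
the D-0079 R-H row 27 «reach-ledger» door (`Summit.ABC.IUTFork.Repair.RH.ReachLedgerDoor.statement_pilotDataOfK_of_hStarReachLedgerK_of_innerOuterUnit`):
its outer certificate at the table column `rOutSharp = B♯` is unavailable EXACTLY at bad places of cyclotomic type.
Classical `p`-adic analysis [cite: NeukirchANT1999, Ch. II Prop. (5.5)–(5.7)] [cite: Washington1997, Lemma 1.4, §5.1];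
nothing here is disputed mathematics; no IUT statement is asserted; nothing bears on [IUTchIII] Cor. 3.12.
-/

noncomputable section

open Metric Set IsUltrametricDist IsLocalRing
open scoped Pointwise NormedField

namespace Literature.IUT.LogVolume

namespace ValuationProfile

open Literature.NumberTheory.GaloisRepresentations.Ultrametric RamificationCriterion LogEnvelope
  BoundaryRamification

section Field

variable (p : ℕ) [hp : Fact p.Prime]
variable {K : Type*} [NontriviallyNormedField K] [instK : NormedAlgebra ℚ_[p] K] [IsUltrametricDist K]
  [ProperSpace K]

/-! ### §1. Two dominant terms that CANCEL: upper bounds -/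

/-- **Two dominant terms that cancel bound the norm.**  If the terms of indices `n₀ + 1 ≠ n₁ + 1` of `L(y)` have SUM of
norm `≤ ‖ϖ‖^{N₀+1}` and every other term has exponent `≥ N₀ + 1`, then `‖L(y)‖ ≤ ‖ϖ‖^{N₀+1}` (`y` principal) — the
cancelling twin of `norm_logSeries_eq_zpow_of_two_dominant`. [cite: NeukirchANT1999, Ch. II Prop. (5.5)] -/
theorem norm_logSeries_le_zpow_succ_of_two_dominant {ϖ : Kˣ} (hϖ : IsUniformizer ϖ) {y : K} (hyP : IsPrincipal y)
    {s : ℤ} (hy : ‖1 - y‖ = ‖(ϖ : K)‖ ^ s) {n₀ n₁ : ℕ} (hne : n₀ ≠ n₁) {N₀ : ℤ}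
    (h₀₁ : ‖-((1 - y) ^ (n₀ + 1)) / (n₀ + 1 : K) + -((1 - y) ^ (n₁ + 1)) / (n₁ + 1 : K)‖ ≤ ‖(ϖ : K)‖ ^ (N₀ + 1))
    (h : ∀ n : ℕ, n ≠ n₀ → n ≠ n₁ →
      N₀ + 1 ≤ s * ((n + 1 : ℕ) : ℤ) - (absRamificationIdx p K : ℤ) * (padicValNat p (n + 1) : ℤ)) :
    ‖logSeries y‖ ≤ ‖(ϖ : K)‖ ^ (N₀ + 1) := by
  classical
  have hρ0 : 0 < ‖(ϖ : K)‖ := norm_units_pos ϖ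
  set f : ℕ → K := fun n ↦ -((1 - y) ^ (n + 1)) / (n + 1 : K) with hf
  have hsum : HasSum f (logSeries y) := hasSum_logSeries p hyP
  have hsum₁ : HasSum (fun n ↦ if n = n₀ then 0 else f n) (logSeries y - f n₀) := hasSum_ite_sub_hasSum hsum n₀
  have hsum₂ : HasSum (fun n ↦ if n = n₁ then 0 else (if n = n₀ then 0 else f n))
      ((logSeries y - f n₀) - (if n₁ = n₀ then 0 else f n₁)) := hasSum_ite_sub_hasSum hsum₁ n₁
  rw [if_neg (Ne.symm hne)] at hsum₂
  have hterm : ∀ n, ‖f n‖ = ‖(ϖ : K)‖ ^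
      (s * ((n + 1 : ℕ) : ℤ) - (absRamificationIdx p K : ℤ) * (padicValNat p (n + 1) : ℤ)) :=
    fun n ↦ norm_logTerm_eq_zpow p hϖ hy n
  have hrest : ‖logSeries y - f n₀ - f n₁‖ ≤ ‖(ϖ : K)‖ ^ (N₀ + 1) := by
    rw [← hsum₂.tsum_eq]
    refine IsUltrametricDist.norm_tsum_le_of_forall_le_of_nonneg (zpow_pos hρ0 _).le fun n ↦ ?_
    by_cases hn1 : n = n₁
    · rw [if_pos hn1, norm_zero]; exact (zpow_pos hρ0 _).le
    by_cases hn0 : n = n₀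
    · rw [if_neg hn1, if_pos hn0, norm_zero]; exact (zpow_pos hρ0 _).le
    rw [if_neg hn1, if_neg hn0, hterm n]
    exact zpow_le_zpow_right_of_le_one₀ hρ0 hϖ.1.le (h n hn0 hn1)
  have hsplit : logSeries y = (f n₀ + f n₁) + (logSeries y - f n₀ - f n₁) := by ring
  rw [hsplit]
  exact (IsUltrametricDist.norm_add_le_max _ _).trans (max_le h₀₁ hrest)

/-- **Sum of the two tying terms under a FAILED unit test.**  `x = 1 − y`, `‖x‖ = ‖ϖ‖ˢ`, indices `n₀ + 1 = p^{a₀}`,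
`n₁ + 1 = p^{a₀+1}`, and `‖1 + x^{p^{a₀}(p−1)}/p‖ ≤ ‖ϖ‖` ⇒ the two terms sum to norm `≤ ‖ϖ‖^{s·p^{a₀} − e·a₀ + 1}` (their sum
is the first times `1 + x^{p^{a₀}(p−1)}/p`, as in `norm_add_eq_of_tie_of_unit`). [cite: NeukirchANT1999, Ch. II Prop. (5.5)] -/
theorem norm_add_le_of_tie_of_norm_le {ϖ : Kˣ} (hϖ : IsUniformizer ϖ) {y : K} {s : ℤ}
    (hy : ‖1 - y‖ = ‖(ϖ : K)‖ ^ s) {a₀ : ℕ} {n₀ n₁ : ℕ} (hn₀ : n₀ + 1 = p ^ a₀)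
    (hn₁ : n₁ + 1 = p ^ (a₀ + 1)) (hfail : ‖1 + (1 - y) ^ (p ^ a₀ * (p - 1)) / (p : K)‖ ≤ ‖(ϖ : K)‖) :
    ‖-((1 - y) ^ (n₀ + 1)) / (n₀ + 1 : K) + -((1 - y) ^ (n₁ + 1)) / (n₁ + 1 : K)‖ ≤
      ‖(ϖ : K)‖ ^ (s * (p : ℤ) ^ a₀ - (absRamificationIdx p K : ℤ) * (a₀ : ℤ) + 1) := by
  have hρ0 : 0 < ‖(ϖ : K)‖ := norm_units_pos ϖ
  have hp0 : (p : K) ≠ 0 := prime_ne_zero p K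
  have hT₀ : ‖-((1 - y) ^ (n₀ + 1)) / (n₀ + 1 : K)‖ =
      ‖(ϖ : K)‖ ^ (s * (p : ℤ) ^ a₀ - (absRamificationIdx p K : ℤ) * (a₀ : ℤ)) := by
    rw [norm_logTerm_eq_zpow p hϖ hy n₀, hn₀, padicValNat.prime_pow]
    push_cast
    ring_nf
  have hcast₀ : ((n₀ : K) + 1) = (p : K) ^ a₀ := by rw [← Nat.cast_pow, ← hn₀, Nat.cast_succ]
  have hcast₁ : ((n₁ : K) + 1) = (p : K) ^ (a₀ + 1) := by rw [← Nat.cast_pow, ← hn₁, Nat.cast_succ]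
  have hp1 : 1 ≤ p := hp.out.one_le
  have hfac : -((1 - y) ^ (n₀ + 1)) / (n₀ + 1 : K) + -((1 - y) ^ (n₁ + 1)) / (n₁ + 1 : K) =
      (-((1 - y) ^ (n₀ + 1)) / (n₀ + 1 : K)) * (1 + (1 - y) ^ (p ^ a₀ * (p - 1)) / (p : K)) := by
    rw [hcast₀, hcast₁, hn₀, hn₁]
    have hexp : p ^ (a₀ + 1) = p ^ a₀ * (p - 1) + p ^ a₀ := by
      rw [pow_succ, ← Nat.mul_add_one, Nat.sub_add_cancel hp1]
    rw [hexp, pow_add, pow_succ, pow_mul]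
    field_simp
    ring
  rw [hfac, norm_mul, hT₀, zpow_add_one₀ hρ0.ne']
  exact mul_le_mul_of_nonneg_left hfail (zpow_nonneg hρ0.le _)

/-- **Upper bound at a TIE under a FAILED unit test**: `‖1 − y‖ = ‖ϖ‖ˢ` (`y` principal), `s·pᵃ·(p−1) < e` for `a < a₀`,
`e = s·p^{a₀}·(p−1)`, and `‖1 + (1−y)^{p^{a₀}(p−1)}/p‖ ≤ ‖ϖ‖` ⟹ `‖L(y)‖ ≤ ‖ϖ‖^{s·p^{a₀} − e·a₀ + 1}` (the two dominant terms
cancel to that order, §1; every other index has exponent `≥ N₀ + 1`, rp-d4's `exponent_lower_of_tie`).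
[cite: NeukirchANT1999, Ch. II Prop. (5.5)] -/
theorem norm_logSeries_le_zpow_succ_of_tie_of_norm_le {ϖ : Kˣ} (hϖ : IsUniformizer ϖ) {y : K} (hyP : IsPrincipal y)
    {s : ℤ} (hy : ‖1 - y‖ = ‖(ϖ : K)‖ ^ s) {a₀ : ℕ}
    (hlo : ∀ a < a₀, s * (p : ℤ) ^ a * ((p : ℤ) - 1) < absRamificationIdx p K)
    (htie : (absRamificationIdx p K : ℤ) = s * (p : ℤ) ^ a₀ * ((p : ℤ) - 1))
    (hfail : ‖1 + (1 - y) ^ (p ^ a₀ * (p - 1)) / (p : K)‖ ≤ ‖(ϖ : K)‖) :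
    ‖logSeries y‖ ≤ ‖(ϖ : K)‖ ^ (s * (p : ℤ) ^ a₀ - (absRamificationIdx p K : ℤ) * (a₀ : ℤ) + 1) := by
  classical
  have hρ0 : 0 < ‖(ϖ : K)‖ := norm_units_pos ϖ
  have hs1 : 1 ≤ s := by
    have h1 : ‖(ϖ : K)‖ ^ s < 1 := hy ▸ hyP
    have := (zpow_lt_one_iff_right_of_lt_one₀ hρ0 hϖ.1).mp h1
    omega
  have hE : (1 : ℤ) ≤ (absRamificationIdx p K : ℤ) := by exact_mod_cast absRamificationIdx_pos p K
  obtain ⟨n₀, hn₀⟩ : ∃ n₀ : ℕ, n₀ + 1 = p ^ a₀ := ⟨p ^ a₀ - 1, Nat.sub_add_cancel (Nat.one_le_pow _ _ hp.out.pos)⟩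
  obtain ⟨n₁, hn₁⟩ : ∃ n₁ : ℕ, n₁ + 1 = p ^ (a₀ + 1) :=
    ⟨p ^ (a₀ + 1) - 1, Nat.sub_add_cancel (Nat.one_le_pow _ _ hp.out.pos)⟩
  have hne : n₀ ≠ n₁ := by
    intro h
    have : p ^ a₀ = p ^ (a₀ + 1) := by rw [← hn₀, ← hn₁, h]
    exact absurd (Nat.pow_right_injective hp.out.two_le this) (by omega)
  refine norm_logSeries_le_zpow_succ_of_two_dominant p hϖ hyP hy hne
    (norm_add_le_of_tie_of_norm_le p hϖ hy hn₀ hn₁ hfail) ?_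
  intro n hn0 hn1
  obtain ⟨a, ha, ha'⟩ := exists_exponent_le_index (p := p) hs1 (absRamificationIdx p K) (Nat.succ_ne_zero n)
  by_cases haa : a = a₀
  · have hne' : n + 1 ≠ p ^ a := by rw [haa, ← hn₀]; intro h; exact hn0 (by omega)
    have := ha' hne'
    rw [haa] at this
    exact this
  by_cases haa' : a = a₀ + 1
  · have hne' : n + 1 ≠ p ^ a := by rw [haa', ← hn₁]; intro h; exact hn1 (by omega)
    have h2 := ha' hne'
    have h01 := exponent_succ_sub s (p : ℤ) (absRamificationIdx p K : ℤ) a₀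
    rw [haa'] at h2
    have : s * (p : ℤ) ^ a₀ * ((p : ℤ) - 1) - (absRamificationIdx p K : ℤ) = 0 := by rw [htie]; ring
    push_cast at h01 h2 ⊢
    linarith
  · exact (exponent_lower_of_tie p hs1 hE hlo htie haa haa').trans ha

/-! ### §2. Cyclotomic type: no unit logarithm reaches the envelope -/

omit instK [IsUltrametricDist K] [ProperSpace K] in
/-- Discreteness: `‖a‖ < 1 ⇒ ‖a‖ ≤ ‖ϖ‖` for a norm uniformizer `ϖ`. [folklore] -/
private theorem norm_le_unif_of_norm_lt_one {ϖ : Kˣ} (hϖ : IsUniformizer ϖ) {a : K} (ha : ‖a‖ < 1) :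
    ‖a‖ ≤ ‖(ϖ : K)‖ := by
  have hρ0 : 0 < ‖(ϖ : K)‖ := norm_units_pos ϖ
  by_cases ha0 : a = 0
  · rw [ha0, norm_zero]; exact hρ0.le
  obtain ⟨j, hj⟩ := hϖ.2 (Units.mk0 a ha0)
  rw [Units.val_mk0] at hj
  rw [hj] at ha ⊢
  have hj1 : 1 ≤ j := by
    have := (zpow_lt_one_iff_right_of_lt_one₀ hρ0 hϖ.1).mp ha; omega
  calc ‖(ϖ : K)‖ ^ j ≤ ‖(ϖ : K)‖ ^ (1 : ℤ) := zpow_le_zpow_right_of_le_one₀ hρ0 hϖ.1.le hj1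
    _ = ‖(ϖ : K)‖ := zpow_one _

/-- **AT CYCLOTOMIC TYPE THE ENVELOPE VALUE IS NOT ATTAINED.**  If `e = p^{a₀}·(p−1)` (a cyclotomic index) and EVERY
element `π` of uniformizer norm fails the unit test, `‖1 + π^{p^{a₀}(p−1)}/p‖ < 1`, then every `z ∈ log_p(𝒪_K^×)` has
`‖z‖ ≤ ‖ϖ‖^{p^{a₀} − e·a₀ + 1}` — one step INSIDE the envelope `‖ϖ‖^{p^{a₀} − e·a₀}`.  Level `1` (`z = m⁻¹·L(uᵐ)`,
`‖1 − uᵐ‖ = ‖ϖ‖`): the two tying terms cancel (§1); level `s ≥ 2`: `‖z‖ ≤ ‖ϖ‖^{N(s)}` and `N(s) ≥ 2p^{a} − e·a ≥ p^{a₀} − e·a₀ + 1`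
(`exponent_min`).  E.g. `K = ℚ_p(ζ_p)`: `a₀ = 0`, `log_p(𝒪^×) = 𝔪²`. [cite: NeukirchANT1999, Ch. II Prop. (5.5)–(5.7)]
[cite: Washington1997, Lemma 1.4, §5.1] -/
theorem norm_le_zpow_succ_of_mem_logUnits_of_cyclotomicType {ϖ : Kˣ} (hϖ : IsUniformizer ϖ) {a₀ : ℕ}
    (he : absRamificationIdx p K = p ^ a₀ * (p - 1))
    (hcyc : ∀ π : K, ‖π‖ = ‖(ϖ : K)‖ → ‖1 + π ^ (p ^ a₀ * (p - 1)) / (p : K)‖ < 1)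
    {z : K} (hz : z ∈ logUnits K) :
    ‖z‖ ≤ ‖(ϖ : K)‖ ^ ((p : ℤ) ^ a₀ - (absRamificationIdx p K : ℤ) * (a₀ : ℤ) + 1) := by
  have hρ0 : 0 < ‖(ϖ : K)‖ := norm_units_pos ϖ
  have hP : (2 : ℤ) ≤ (p : ℤ) := by exact_mod_cast hp.out.two_le
  by_cases hz0 : z = 0
  · rw [hz0, norm_zero]; exact (zpow_pos hρ0 _).le
  obtain ⟨u, m, s, hu, hm0, hmp, hmP, hs1, hum, rfl⟩ := exists_level_of_mem_logUnits p hϖ hz hz0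
  rw [unitLog_eq_inv_mul_logSeries p hm0 hmP, norm_mul, norm_inv, norm_natCast_eq_one_of_not_dvd p hmp,
    inv_one, one_mul]
  -- level-`1` bookkeeping of the cyclotomic index: `a₀` is its turning point
  have htie : (absRamificationIdx p K : ℤ) = 1 * (p : ℤ) ^ a₀ * ((p : ℤ) - 1) := by
    rw [he]; push_cast [Nat.cast_sub hp.out.one_le]; ring
  have hlo : ∀ a < a₀, (1 : ℤ) * (p : ℤ) ^ a * ((p : ℤ) - 1) < absRamificationIdx p K := by
    intro a ha
    rw [htie]
    have hpow : (p : ℤ) ^ a < (p : ℤ) ^ a₀ := pow_lt_pow_right₀ (by linarith) ha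
    have h1 : (0 : ℤ) < (p : ℤ) - 1 := by linarith
    nlinarith
  rcases eq_or_lt_of_le hs1 with hs | hs
  · -- LEVEL 1: `1 − uᵐ` has uniformizer norm, the two tying terms cancel
    rw [← hs, zpow_one] at hum
    have hfail : ‖1 + (1 - u ^ m) ^ (p ^ a₀ * (p - 1)) / (p : K)‖ ≤ ‖(ϖ : K)‖ :=
      norm_le_unif_of_norm_lt_one hϖ (hcyc _ hum)
    have hum' : ‖1 - u ^ m‖ = ‖(ϖ : K)‖ ^ (1 : ℤ) := by rw [hum, zpow_one]
    have h := norm_logSeries_le_zpow_succ_of_tie_of_norm_le p hϖ hmP hum' hlo htie hfail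
    rwa [one_mul] at h
  · -- LEVEL `s ≥ 2`: below its own envelope, which is at least one step inside the level-`1` one
    have hs2 : 2 ≤ s := by omega
    obtain ⟨a₁, hlo₁, hhi₁⟩ := exists_turning_level (p := p) hs1 (absRamificationIdx p K)
    refine (norm_logSeries_le_zpow_level p hϖ hs1 hlo₁ hhi₁ hum).trans
      (zpow_le_zpow_right_of_le_one₀ hρ0 hϖ.1.le ?_)
    have hmin := exponent_min (S := 1) (P := (p : ℤ)) (E := (absRamificationIdx p K : ℤ)) (a₀ := a₀) le_rfl hP
      hlo htie.le a₁
    have hpa : (1 : ℤ) ≤ (p : ℤ) ^ a₁ := one_le_pow₀ (by linarith)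
    rw [one_mul, one_mul] at hmin
    nlinarith

/-- **Corollary: the outer radius is strictly inside the envelope at cyclotomic type** — no `z ∈ log_p(𝒪_K^×)` has norm
`≥ ‖ϖ‖^{p^{a₀} − e·a₀}`. [cite: NeukirchANT1999, Ch. II Prop. (5.5)–(5.7)] -/
theorem not_exists_mem_logUnits_zpow_le_norm_of_cyclotomicType {ϖ : Kˣ} (hϖ : IsUniformizer ϖ) {a₀ : ℕ}
    (he : absRamificationIdx p K = p ^ a₀ * (p - 1))
    (hcyc : ∀ π : K, ‖π‖ = ‖(ϖ : K)‖ → ‖1 + π ^ (p ^ a₀ * (p - 1)) / (p : K)‖ < 1) :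
    ¬ ∃ z ∈ logUnits K, ‖(ϖ : K)‖ ^ ((p : ℤ) ^ a₀ - (absRamificationIdx p K : ℤ) * (a₀ : ℤ)) ≤ ‖z‖ := by
  rintro ⟨z, hz, hle⟩
  have hρ0 : 0 < ‖(ϖ : K)‖ := norm_units_pos ϖ
  have h := norm_le_zpow_succ_of_mem_logUnits_of_cyclotomicType p hϖ he hcyc hz
  have hlt : ‖(ϖ : K)‖ ^ ((p : ℤ) ^ a₀ - (absRamificationIdx p K : ℤ) * (a₀ : ℤ) + 1) <
      ‖(ϖ : K)‖ ^ ((p : ℤ) ^ a₀ - (absRamificationIdx p K : ℤ) * (a₀ : ℤ)) :=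
    zpow_lt_zpow_right_of_lt_one₀ hρ0 hϖ.1 (lt_add_one _)
  exact absurd (hle.trans h) (not_le.mpr hlt)

end Field

end ValuationProfile

end Literature.IUT.LogVolume

end
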